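import Summits.QuantumFields.BalabanUV.Beta.EriceFlowEnclosureB12AsPrintedHistoryContagionShiftFlowZeroTangentSmooth

/-!
# Beta / EriceFlowEnclosureB12AsPrintedHistoryContagionShiftFlowZeroTangentPin — ASYMPTOTIC FREEDOM IS CONTAGIOUS, part 77: THE CHART-DERIVATIVE OF THE HISTORY.  Part 69
# proved `∂_e h_q(e) = W_q h_q³∕e³` at every scale; parts 78–81 differentiate the tangent flow itself, and they do it in the CHART `c = 1∕e²` of the pin, where the flow is
# affine (`1∕h_q² = 1∕e² + drive`) and every derivative is WEIGHTED BY ASYMPTOTIC FREEDOM.  This part is the dictionary.  (§133) The chart-derivative of the running coupling is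
# **`U_q := ∂_c h_q = −(h_q³∕2)·W_q`**, and **`|U_q| ≤ w_q`** — THE AF WEIGHT ITSELF (`w_q = (1∕(4e′²) + (β*∕4)q)^{−3∕2}`, part 67): the ultraviolet couplings forget the pin at the
# summable rate `q^{−3∕2}`.  (§134) For two pins e ≠ ẽ the chart slopes are EXACT: **`(h̃_q − h_q)∕(1∕ẽ² − 1∕e²) = −μ_q·D_q`** (part 68's mixed Jacobian `μ_q = h_q²h̃_q²∕(h_q + h̃_q)`
# and chart quotient `D_q`), hence **`|(h̃_q − h_q)∕δ̂ − U_q| ≤ w_q·((32∕9)e′²|δ̂| + ε_D∕2)`** whenever `sup_k |D_k − W_k| ≤ ε_D` — the slope error is WEIGHTED, at every scale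
# at once, and by part 69 it tends to zero: `∀ ε₀ > 0, ∀ᶠ ẽ, ∀ q, |(h̃_q − h_q)∕δ̂ − U_q| ≤ ε₀·w_q`.  (§135) The same for the chart-to-coupling Jacobian `v_q = h_q³∕2` of part 66's
# kernel: **`∂_c v_q = (3∕2)h_q²U_q = −(3∕4)h_q⁵W_q`**, `|∂_c v_q| ≤ 6e′²·w_q`, and `|(ṽ_q − v_q)∕δ̂ − ∂_c v_q| ≤ ε₀·w_q` eventually, uniformly in q.  These weighted slopes are
# what makes the DERIVED SOURCE of part 78 summable and the second-order quotient identity of part 79 close at all scales at once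
# (β-flow team, prover 1, unit `b2b-balaban-beta-bflow-p1`, gen 43; ROW AP-I·Uc × NODE U2)

HONEST FRAMING (page 1 of everything the β sub-cell writes): discharging `BetaPertH` makes Bałaban's UV stability UNCONDITIONAL — a
real constructive-QFT result; it is NOT the continuum limit and NOT the Clay problem.  HONEST DEPENDENCY (cell reorg 2026-08-19,
verbatim): «continuum YM on T⁴ ⇐ BetaPertH ∧ nine spine estimates (0/9 proved); BetaPertH ⇐ (D1) ∧ (D4) ∧ CAP+tail; G-an2-4 gates
asym, D1 and NE2/3/4.»  THIS MODULE DISCHARGES NOTHING: [folklore] real analysis (three-line algebra of difference quotients, products of bounded and uniformly small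
factors, filters) over node U2's HYPOTHESIS SHAPES `T4BetaStationary.{SeqBox, MemoryProfile}`, `T4BetaFlowWellPosed.{MemFlow, solution}`, `T4CouplingMatching.{sprof}` and parts
67, 68, 69 of this series BY NAME (NOT PRINTED for [I] = T. Bałaban, Commun. Math. Phys. **109** (1987) [Balaban1987RG1]: p. 298 says only that β_j depends on the preceding
couplings; (0.20) p. 256; Theorem 2 (0.31) p. 259 STATED WITHOUT PROOF; derivatives of the coupling flow in its datum are printed nowhere in [I]).  The C¹ shape (`hG`, `hGB`)
is an explicit binder.  Nothing of Bałaban's β is asserted.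

WHAT THIS FILE PROVES (0 sorry, 0 def): §133 **`chartDeriv_facts`**, `invSprof_le_two_mul`; §134 **`chartSlope_eq`**, **`chartSlope_sub_chartDeriv_abs_le`**,
**`chartSlope_tendsto_chartDeriv_uniform`**; §135 `jacobianDeriv_abs_le`, `jacobianSlope_core`, **`jacobianSlope_sub_abs_le`**, **`jacobianSlope_tendsto_uniform`**.  NOT CLAIMED: the derived
linear memory equation (part 78); anything about Bałaban's β; `BetaPertH`; the continuum limit of the measures; Clay.
-/

namespace Summit.QuantumFields.BalabanUV.Beta.EriceFlowEnclosureB12AsPrintedHistoryContagionShiftFlowZeroTangentPin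

open Finset Filter Topology Set
open Literature.MathematicalPhysics.QuantumFieldTheory.Balaban1983to89
open Literature.MathematicalPhysics.QuantumFieldTheory.Balaban1983to89.T4CouplingMatching (sprof sprof_pos sprof_zero)
open Literature.MathematicalPhysics.QuantumFieldTheory.Balaban1983to89.T4BetaStationary (SeqBox MemoryProfile)
open Literature.MathematicalPhysics.QuantumFieldTheory.Balaban1983to89.T4BetaFlowWellPosed (MemFlow solution)
open Summit.QuantumFields.BalabanUV.Beta.EriceFlowEnclosureB12AsPrintedHistoryContagion (sprof_le_sprof)
open Summit.QuantumFields.BalabanUV.Beta.EriceFlowEnclosureB12AsPrintedHistoryContagionShiftFlowZeroTangentLimit (profWeight_nonneg profWeight_anti)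
open Summit.QuantumFields.BalabanUV.Beta.EriceFlowEnclosureB12AsPrintedHistoryContagionShiftFlowZeroTangentFlow (solution_facts tangent_pos quotient_mem_Icc
  sub_eq_mu_mul abs_mu_sub_cube_le)
open Summit.QuantumFields.BalabanUV.Beta.EriceFlowEnclosureB12AsPrintedHistoryContagionShiftFlowZeroTangentDeriv (invSq_sub_ne_zero abs_sub_pins_le_of_quotient
  invSq_sub_invSq_tendsto_zero quotient_tendsto_tangent_uniform)

noncomputable section

/-! ## §133 The chart-derivative of the running coupling is weighted by asymptotic freedom -/

/-- **THE CHART-DERIVATIVE OF THE HISTORY IS BELOW THE AF WEIGHT.**  Part 14's package at e′, the gradient profile `hG`, `e ∈ ]0, e′]`, W the tangent flow at e, `h = solution B e`.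
The quantity `(h_q³∕2)·W_q` — minus the derivative of `h_q` in the chart `c = 1∕e²` of the pin (part 69: `∂_e h_q = W_q h_q³∕e³ = (−2∕e³)·(−(h_q³∕2)W_q)`) — is POSITIVE and
**`(h_q³∕2)·W_q ≤ w_q = (1∕(4e′²) + (β*∕4)q)^{−3∕2}`** at every scale (`h_q³ ≤ w_q` by part 68's `solution_facts`, `0 < W_q ≤ 2`): summable over the scales with
`Σ_q w_q ≤ 8e′³ + 16e′∕β*` (part 67). [cite: Balaban1987RG1, Thm 2 (0.31) p.259 with (0.20) p.256 and p.298] -/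
theorem chartDeriv_facts {B : (ℕ → ℝ) → ℝ} {G : (ℕ → ℝ) → ℕ → ℝ} {Cm θ γ bs ta gs e' : ℝ} {t W : ℕ → ℝ}
    (hB : MemoryProfile Cm θ γ B) (hCm : 0 ≤ Cm) (hθ0 : 0 ≤ θ) (hθ1 : θ < 1) (hbs : 0 < bs) (hta : 0 < ta)
    (hts : SeqBox γ t) (htf : MemFlow B gs t) (hprof : ∀ m : ℕ, 1 / ta ^ 2 + bs * (m : ℝ) ≤ 1 / (t m) ^ 2)
    (hG : ∀ u : ℕ → ℝ, SeqBox γ u → ∀ j, |G u j| ≤ Cm * θ ^ j)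
    (h2e' : 2 * e' ≤ γ) (hs1 : 4 * Cm * e' ≤ bs * (1 - θ))
    (hs2 : e' ^ 2 * (1 / gs ^ 2 + Cm * γ / (1 - θ) ^ 2 + (2 * Cm / ((1 - θ) * bs)) ^ 2) ≤ 3 / 4)
    (hs4 : 64 * Cm * e' ^ 3 ≤ (1 - θ) ^ 2) (hs5 : Cm * (8 * e' ^ 3 + 16 * e' / bs) ≤ (1 - θ) / 4) {e : ℝ} (he : e ∈ Ioc (0 : ℝ) e')
    (hW : ∀ k, W k = 1 - ∑ p ∈ range k, ∑' j, G (fun i => solution B e (p + 1 + i)) j * ((solution B e (p + 1 + j)) ^ 3 / 2) * W (p + 1 + j))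
    (hWM : ∀ k, |W k| ≤ 2) (q : ℕ) :
    0 < (solution B e q) ^ 3 / 2 * W q ∧
      (solution B e q) ^ 3 / 2 * W q ≤ 1 / (sprof (2 * e') (bs / 4) q) ^ 2 * (1 / sprof (2 * e') (bs / 4) q) ∧
      |(solution B e q) ^ 3 / 2 * W q| ≤ 1 / (sprof (2 * e') (bs / 4) q) ^ 2 * (1 / sprof (2 * e') (bs / 4) q) := by
  have he' : 0 < e' := he.1.trans_le he.2
  obtain ⟨hsb, -, -, -, -, hcube⟩ := solution_facts hB hCm hθ0 hθ1 hbs hta hts htf hprof h2e' hs1 hs2 hs4 hs5 he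
  have hWpos : 0 < W q := tangent_pos hB hCm hθ0 hθ1 hbs hta hts htf hprof hG h2e' hs1 hs2 hs4 hs5 he hW hWM q
  have hW2 : W q ≤ 2 := (abs_le.mp (hWM q)).2
  have hh := (hsb q).1
  have hpos : 0 < (solution B e q) ^ 3 / 2 * W q := mul_pos (by positivity) hWpos
  have hle : (solution B e q) ^ 3 / 2 * W q ≤ 1 / (sprof (2 * e') (bs / 4) q) ^ 2 * (1 / sprof (2 * e') (bs / 4) q) := by
    have hw0 := profWeight_nonneg hbs he' q
    calc (solution B e q) ^ 3 / 2 * W q ≤ (1 / (sprof (2 * e') (bs / 4) q) ^ 2 * (1 / sprof (2 * e') (bs / 4) q)) / 2 * 2 :=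
          mul_le_mul (by linarith [hcube q]) hW2 hWpos.le (by positivity)
      _ = 1 / (sprof (2 * e') (bs / 4) q) ^ 2 * (1 / sprof (2 * e') (bs / 4) q) := by ring
  exact ⟨hpos, hle, by rw [abs_of_pos hpos]; exact hle⟩

/-- The AF coupling profile is below its value at the pin: `(1∕(4f²) + (β*∕4)q)^{−1∕2} ≤ 2f`, hence its square is `≤ 4f²`. [folklore] -/
theorem invSprof_le_two_mul {bs f : ℝ} (hbs : 0 < bs) (hf : 0 < f) (q : ℕ) :
    1 / sprof (2 * f) (bs / 4) q ≤ 2 * f ∧ (1 / sprof (2 * f) (bs / 4) q) ^ 2 ≤ 4 * f ^ 2 ∧ 0 < 1 / sprof (2 * f) (bs / 4) q := by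
  have h2f : (0 : ℝ) < 2 * f := by positivity
  have hb4 : (0 : ℝ) ≤ bs / 4 := by positivity
  have hp0 := sprof_pos h2f hb4 0
  have hpq := sprof_pos h2f hb4 q
  have h1 : 1 / sprof (2 * f) (bs / 4) q ≤ 1 / sprof (2 * f) (bs / 4) 0 := one_div_le_one_div_of_le hp0 (sprof_le_sprof hb4 (Nat.zero_le q))
  rw [sprof_zero h2f, one_div_one_div] at h1
  have h0 : 0 < 1 / sprof (2 * f) (bs / 4) q := one_div_pos.mpr hpq
  refine ⟨h1, ?_, h0⟩
  nlinarith

/-! ## §134 The chart slopes of the history: exact, and uniformly close to the chart-derivative -/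

/-- **THE CHART SLOPE IS EXACT**: for two pins e ≠ ẽ of ]0, e′] and every scale, **`(h̃_q − h_q)∕(1∕ẽ² − 1∕e²) = −μ_q·D_q`** with part 68's mixed Jacobian
`μ_q = h_q²h̃_q²∕(h_q + h̃_q)` and chart quotient `D_q = (1∕h̃_q² − 1∕h_q²)∕(1∕ẽ² − 1∕e²)` (part 68's `sub_eq_mu_mul`). [folklore] -/
theorem chartSlope_eq {B : (ℕ → ℝ) → ℝ} {Cm θ γ bs ta gs e' : ℝ} {t : ℕ → ℝ}
    (hB : MemoryProfile Cm θ γ B) (hCm : 0 ≤ Cm) (hθ0 : 0 ≤ θ) (hθ1 : θ < 1) (hbs : 0 < bs) (hta : 0 < ta)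
    (hts : SeqBox γ t) (htf : MemFlow B gs t) (hprof : ∀ m : ℕ, 1 / ta ^ 2 + bs * (m : ℝ) ≤ 1 / (t m) ^ 2)
    (h2e' : 2 * e' ≤ γ) (hs1 : 4 * Cm * e' ≤ bs * (1 - θ))
    (hs2 : e' ^ 2 * (1 / gs ^ 2 + Cm * γ / (1 - θ) ^ 2 + (2 * Cm / ((1 - θ) * bs)) ^ 2) ≤ 3 / 4)
    (hs4 : 64 * Cm * e' ^ 3 ≤ (1 - θ) ^ 2) (hs5 : Cm * (8 * e' ^ 3 + 16 * e' / bs) ≤ (1 - θ) / 4)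
    {e ee : ℝ} (he : e ∈ Ioc (0 : ℝ) e') (hee : ee ∈ Ioc (0 : ℝ) e') (hne : ee ≠ e) (q : ℕ) :
    (solution B ee q - solution B e q) / (1 / ee ^ 2 - 1 / e ^ 2)
      = -(solution B e q ^ 2 * solution B ee q ^ 2 / (solution B e q + solution B ee q))
          * ((1 / (solution B ee q) ^ 2 - 1 / (solution B e q) ^ 2) / (1 / ee ^ 2 - 1 / e ^ 2)) := by
  obtain ⟨hsb, -⟩ := solution_facts hB hCm hθ0 hθ1 hbs hta hts htf hprof h2e' hs1 hs2 hs4 hs5 he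
  obtain ⟨hsbb, -⟩ := solution_facts hB hCm hθ0 hθ1 hbs hta hts htf hprof h2e' hs1 hs2 hs4 hs5 hee
  have hδne : 1 / ee ^ 2 - 1 / e ^ 2 ≠ 0 := invSq_sub_ne_zero he.1 hee.1 hne
  rw [sub_eq_mu_mul (hsb q).1 (hsbb q).1]
  field_simp

/-- **THE CHART SLOPES AGAINST THE CHART-DERIVATIVE, AT EVERY SCALE AT ONCE, WITH THE WEIGHT.**  Part 14's package at e′, `e ∈ ]0, e′]`, a second pin `ẽ ≠ e` in ]0, e′], ANY
comparison sequence W (the tangent flow at e in every use) and a bound `ε_D` on part 69's chart-quotient error `sup_k |D_k − W_k|`.  THEN for EVERY q: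
**`|(h̃_q − h_q)∕δ̂ + (h_q³∕2)W_q| ≤ w_q·((32∕9)·e′²·|δ̂| + ε_D∕2)`**, `δ̂ = 1∕ẽ² − 1∕e²` (`−μD + vW = (v − μ)D − v(D − W)` with `|μ − v| ≤ h²|h̃ − h| ≤ 4e′²·(2∕3)w|δ̂|` (parts
68–69), `|D| ≤ 4∕3`, `v = h³∕2 ≤ w∕2`). [cite: Balaban1987RG1, Thm 2 (0.31) p.259 with (0.20) p.256 and p.298] -/
theorem chartSlope_sub_chartDeriv_abs_le {B : (ℕ → ℝ) → ℝ} {Cm θ γ bs ta gs e' εD : ℝ} {t W : ℕ → ℝ}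
    (hB : MemoryProfile Cm θ γ B) (hCm : 0 ≤ Cm) (hθ0 : 0 ≤ θ) (hθ1 : θ < 1) (hbs : 0 < bs) (hta : 0 < ta)
    (hts : SeqBox γ t) (htf : MemFlow B gs t) (hprof : ∀ m : ℕ, 1 / ta ^ 2 + bs * (m : ℝ) ≤ 1 / (t m) ^ 2)
    (h2e' : 2 * e' ≤ γ) (hs1 : 4 * Cm * e' ≤ bs * (1 - θ))
    (hs2 : e' ^ 2 * (1 / gs ^ 2 + Cm * γ / (1 - θ) ^ 2 + (2 * Cm / ((1 - θ) * bs)) ^ 2) ≤ 3 / 4)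
    (hs4 : 64 * Cm * e' ^ 3 ≤ (1 - θ) ^ 2) (hs5 : Cm * (8 * e' ^ 3 + 16 * e' / bs) ≤ (1 - θ) / 4)
    {e ee : ℝ} (he : e ∈ Ioc (0 : ℝ) e') (hee : ee ∈ Ioc (0 : ℝ) e') (hne : ee ≠ e)
    (hD : ∀ k, |(1 / (solution B ee k) ^ 2 - 1 / (solution B e k) ^ 2) / (1 / ee ^ 2 - 1 / e ^ 2) - W k| ≤ εD) (q : ℕ) :
    |(solution B ee q - solution B e q) / (1 / ee ^ 2 - 1 / e ^ 2) + (solution B e q) ^ 3 / 2 * W q|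
      ≤ (1 / (sprof (2 * e') (bs / 4) q) ^ 2 * (1 / sprof (2 * e') (bs / 4) q)) * (32 / 9 * e' ^ 2 * |1 / ee ^ 2 - 1 / e ^ 2| + εD / 2) := by
  have he' : 0 < e' := he.1.trans_le he.2
  obtain ⟨hsb, -, -, hle, -, hcube⟩ := solution_facts hB hCm hθ0 hθ1 hbs hta hts htf hprof h2e' hs1 hs2 hs4 hs5 he
  obtain ⟨hsbb, -⟩ := solution_facts hB hCm hθ0 hθ1 hbs hta hts htf hprof h2e' hs1 hs2 hs4 hs5 hee
  obtain ⟨-, -, hDq⟩ := quotient_mem_Icc hB hCm hθ0 hθ1 hbs hta hts htf hprof h2e' hs1 hs2 hs4 hs5 he hee hne q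
  obtain ⟨hba, -⟩ := abs_sub_pins_le_of_quotient hB hCm hθ0 hθ1 hbs hta hts htf hprof h2e' hs1 hs2 hs4 hs5 he hee hne q
  obtain ⟨-, hσ2, -⟩ := invSprof_le_two_mul hbs he' q
  set a : ℝ := solution B e q with ha
  set b : ℝ := solution B ee q with hb
  set δ : ℝ := 1 / ee ^ 2 - 1 / e ^ 2 with hδ
  set D : ℝ := (1 / b ^ 2 - 1 / a ^ 2) / δ with hDdef
  set μ : ℝ := a ^ 2 * b ^ 2 / (a + b) with hμ
  set w : ℝ := 1 / (sprof (2 * e') (bs / 4) q) ^ 2 * (1 / sprof (2 * e') (bs / 4) q) with hw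
  set σ : ℝ := 1 / sprof (2 * e') (bs / 4) q with hσ
  have ha0 : 0 < a := (hsb q).1
  have hb0 : 0 < b := (hsbb q).1
  have hw0 : 0 ≤ w := profWeight_nonneg hbs he' q
  have hεD : 0 ≤ εD := (abs_nonneg _).trans (hD 0)
  have hslope : (b - a) / δ = -μ * D := chartSlope_eq hB hCm hθ0 hθ1 hbs hta hts htf hprof h2e' hs1 hs2 hs4 hs5 he hee hne q
  rw [hslope]
  have hsplit : -μ * D + a ^ 3 / 2 * W q = (a ^ 3 / 2 - μ) * D - a ^ 3 / 2 * (D - W q) := by ring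
  rw [hsplit]
  have hμv : |a ^ 3 / 2 - μ| ≤ a ^ 2 * |b - a| := by rw [abs_sub_comm]; exact abs_mu_sub_cube_le ha0 hb0
  have ha2 : a ^ 2 ≤ σ ^ 2 := pow_le_pow_left₀ ha0.le (hle q) 2
  have hv0 : 0 ≤ a ^ 3 / 2 := by positivity
  have hv : a ^ 3 / 2 ≤ w / 2 := by linarith [hcube q]
  have h1 : |(a ^ 3 / 2 - μ) * D| ≤ σ ^ 2 * (2 / 3 * w * |δ|) * (4 / 3) := by
    rw [abs_mul]
    refine mul_le_mul (hμv.trans ?_) hDq (abs_nonneg _) (by positivity)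
    exact mul_le_mul ha2 hba (abs_nonneg _) (by positivity)
  have h2 : |a ^ 3 / 2 * (D - W q)| ≤ w / 2 * εD := by
    rw [abs_mul, abs_of_nonneg hv0]
    exact mul_le_mul hv (hD q) (abs_nonneg _) (by positivity)
  calc |(a ^ 3 / 2 - μ) * D - a ^ 3 / 2 * (D - W q)| ≤ |(a ^ 3 / 2 - μ) * D| + |a ^ 3 / 2 * (D - W q)| := abs_sub _ _
    _ ≤ σ ^ 2 * (2 / 3 * w * |δ|) * (4 / 3) + w / 2 * εD := add_le_add h1 h2
    _ ≤ 4 * e' ^ 2 * (2 / 3 * w * |δ|) * (4 / 3) + w / 2 * εD := by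
        have : 0 ≤ 2 / 3 * w * |δ| := by positivity
        nlinarith
    _ = w * (32 / 9 * e' ^ 2 * |δ| + εD / 2) := by ring

/-- **THE CHART SLOPES OF THE HISTORY CONVERGE TO THE CHART-DERIVATIVE, UNIFORMLY IN THE SCALE, WITH THE WEIGHT.**  Part 14's package at e′, part 68's C¹ shape (`hG`,
`hGB`), an INTERIOR pin `e ∈ ]0, e′[`, W the tangent flow at e.  THEN for every ε₀ > 0, for all ẽ ≠ e close enough to e: ẽ ∈ ]0, e′] and
**`|(h̃_q − h_q)∕(1∕ẽ² − 1∕e²) + (h_q³∕2)W_q| ≤ ε₀·w_q` FOR EVERY q** (part 69's `quotient_tendsto_tangent_uniform` inside `chartSlope_sub_chartDeriv_abs_le`).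
[cite: Balaban1987RG1, Thm 2 (0.31) p.259 with (0.20) p.256 and p.298] -/
theorem chartSlope_tendsto_chartDeriv_uniform {B : (ℕ → ℝ) → ℝ} {G : (ℕ → ℝ) → ℕ → ℝ} {Cm θ γ bs ta gs e' : ℝ} {t W : ℕ → ℝ}
    (hB : MemoryProfile Cm θ γ B) (hCm : 0 ≤ Cm) (hθ0 : 0 ≤ θ) (hθ1 : θ < 1) (hbs : 0 < bs) (hta : 0 < ta)
    (hts : SeqBox γ t) (htf : MemFlow B gs t) (hprof : ∀ m : ℕ, 1 / ta ^ 2 + bs * (m : ℝ) ≤ 1 / (t m) ^ 2)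
    (hG : ∀ u : ℕ → ℝ, SeqBox γ u → ∀ j, |G u j| ≤ Cm * θ ^ j)
    (hGB : ∀ ε > 0, ∃ ρ > 0, ∀ u u' : ℕ → ℝ, SeqBox γ u → SeqBox γ u' → (∀ j, |u' j - u j| ≤ ρ) →
      |B u' - B u - ∑' j, G u j * (u' j - u j)| ≤ ε * ∑' j, θ ^ j * |u' j - u j|)
    (h2e' : 2 * e' ≤ γ) (hs1 : 4 * Cm * e' ≤ bs * (1 - θ))
    (hs2 : e' ^ 2 * (1 / gs ^ 2 + Cm * γ / (1 - θ) ^ 2 + (2 * Cm / ((1 - θ) * bs)) ^ 2) ≤ 3 / 4)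
    (hs4 : 64 * Cm * e' ^ 3 ≤ (1 - θ) ^ 2) (hs5 : Cm * (8 * e' ^ 3 + 16 * e' / bs) ≤ (1 - θ) / 4) {e : ℝ} (he : e ∈ Ioo (0 : ℝ) e')
    (hW : ∀ k, W k = 1 - ∑ p ∈ range k, ∑' j, G (fun i => solution B e (p + 1 + i)) j * ((solution B e (p + 1 + j)) ^ 3 / 2) * W (p + 1 + j))
    (hWM : ∀ k, |W k| ≤ 2) {ε₀ : ℝ} (hε₀ : 0 < ε₀) :
    ∀ᶠ ee in 𝓝[≠] e, ee ∈ Ioc (0 : ℝ) e' ∧ ∀ q,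
      |(solution B ee q - solution B e q) / (1 / ee ^ 2 - 1 / e ^ 2) + (solution B e q) ^ 3 / 2 * W q|
        ≤ ε₀ * (1 / (sprof (2 * e') (bs / 4) q) ^ 2 * (1 / sprof (2 * e') (bs / 4) q)) := by
  have he' : 0 < e' := he.1.trans he.2
  have hec : e ∈ Ioc (0 : ℝ) e' := ⟨he.1, he.2.le⟩
  have hD := quotient_tendsto_tangent_uniform hB hCm hθ0 hθ1 hbs hta hts htf hprof hG hGB h2e' hs1 hs2 hs4 hs5 he hW hWM hε₀
  have hsmall : ∀ᶠ ee in 𝓝 e, 32 / 9 * e' ^ 2 * |1 / ee ^ 2 - 1 / e ^ 2| ≤ ε₀ / 2 := by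
    have h := invSq_sub_invSq_tendsto_zero he.1.ne'
    have hpos : 0 < 9 * ε₀ / (64 * e' ^ 2) := by positivity
    have := (Metric.tendsto_nhds.1 h) _ hpos
    refine this.mono fun ee hee => ?_
    rw [Real.dist_eq, sub_zero] at hee
    have := (lt_div_iff₀ (by positivity : (0:ℝ) < 64 * e' ^ 2)).mp hee
    nlinarith [sq_nonneg e', abs_nonneg (1 / ee ^ 2 - 1 / e ^ 2)]
  have hmem : ∀ᶠ ee in 𝓝 e, ee ∈ Ioc (0 : ℝ) e' := Filter.eventually_of_mem (Ioo_mem_nhds he.1 he.2) fun x hx => ⟨hx.1, hx.2.le⟩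
  have hne : ∀ᶠ ee in 𝓝[≠] e, ee ≠ e := self_mem_nhdsWithin
  filter_upwards [hne, hD, eventually_nhdsWithin_of_eventually_nhds hsmall, eventually_nhdsWithin_of_eventually_nhds hmem] with ee hne' hD' hsm hee
  refine ⟨hee, fun q => ?_⟩
  have hw0 := profWeight_nonneg hbs he' q
  have hmain := chartSlope_sub_chartDeriv_abs_le hB hCm hθ0 hθ1 hbs hta hts htf hprof h2e' hs1 hs2 hs4 hs5 hec hee hne' hD' q
  calc _ ≤ (1 / (sprof (2 * e') (bs / 4) q) ^ 2 * (1 / sprof (2 * e') (bs / 4) q)) * (32 / 9 * e' ^ 2 * |1 / ee ^ 2 - 1 / e ^ 2| + ε₀ / 2) := hmain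
    _ ≤ (1 / (sprof (2 * e') (bs / 4) q) ^ 2 * (1 / sprof (2 * e') (bs / 4) q)) * (ε₀ / 2 + ε₀ / 2) :=
        mul_le_mul_of_nonneg_left (by linarith) hw0
    _ = ε₀ * (1 / (sprof (2 * e') (bs / 4) q) ^ 2 * (1 / sprof (2 * e') (bs / 4) q)) := by ring

/-! ## §135 The chart slopes of the Jacobian `v_q = h_q³∕2` -/

/-- **THE CHART-DERIVATIVE OF THE JACOBIAN IS WEIGHTED**: `∂_c v_q = (3∕2)h_q²·U_q = −(3∕4)h_q⁵W_q` with **`|(3∕4)h_q⁵W_q| ≤ (3∕2)σ_q²·w_q ≤ 6e′²·w_q`**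
(`σ_q = (1∕(4e′²) + (β*∕4)q)^{−1∕2} ≤ 2e′` bounds h_q, part 68). [folklore] -/
theorem jacobianDeriv_abs_le {B : (ℕ → ℝ) → ℝ} {G : (ℕ → ℝ) → ℕ → ℝ} {Cm θ γ bs ta gs e' : ℝ} {t W : ℕ → ℝ}
    (hB : MemoryProfile Cm θ γ B) (hCm : 0 ≤ Cm) (hθ0 : 0 ≤ θ) (hθ1 : θ < 1) (hbs : 0 < bs) (hta : 0 < ta)
    (hts : SeqBox γ t) (htf : MemFlow B gs t) (hprof : ∀ m : ℕ, 1 / ta ^ 2 + bs * (m : ℝ) ≤ 1 / (t m) ^ 2)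
    (hG : ∀ u : ℕ → ℝ, SeqBox γ u → ∀ j, |G u j| ≤ Cm * θ ^ j)
    (h2e' : 2 * e' ≤ γ) (hs1 : 4 * Cm * e' ≤ bs * (1 - θ))
    (hs2 : e' ^ 2 * (1 / gs ^ 2 + Cm * γ / (1 - θ) ^ 2 + (2 * Cm / ((1 - θ) * bs)) ^ 2) ≤ 3 / 4)
    (hs4 : 64 * Cm * e' ^ 3 ≤ (1 - θ) ^ 2) (hs5 : Cm * (8 * e' ^ 3 + 16 * e' / bs) ≤ (1 - θ) / 4) {e : ℝ} (he : e ∈ Ioc (0 : ℝ) e')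
    (hW : ∀ k, W k = 1 - ∑ p ∈ range k, ∑' j, G (fun i => solution B e (p + 1 + i)) j * ((solution B e (p + 1 + j)) ^ 3 / 2) * W (p + 1 + j))
    (hWM : ∀ k, |W k| ≤ 2) (q : ℕ) :
    |3 / 4 * (solution B e q) ^ 5 * W q| ≤ 3 / 2 * (1 / sprof (2 * e') (bs / 4) q) ^ 2 * (1 / (sprof (2 * e') (bs / 4) q) ^ 2 * (1 / sprof (2 * e') (bs / 4) q)) ∧
      |3 / 4 * (solution B e q) ^ 5 * W q| ≤ 6 * e' ^ 2 * (1 / (sprof (2 * e') (bs / 4) q) ^ 2 * (1 / sprof (2 * e') (bs / 4) q)) := by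
  have he' : 0 < e' := he.1.trans_le he.2
  obtain ⟨hsb, -, -, hle, -, -⟩ := solution_facts hB hCm hθ0 hθ1 hbs hta hts htf hprof h2e' hs1 hs2 hs4 hs5 he
  obtain ⟨-, -, hU⟩ := chartDeriv_facts hB hCm hθ0 hθ1 hbs hta hts htf hprof hG h2e' hs1 hs2 hs4 hs5 he hW hWM q
  obtain ⟨-, hσ2, -⟩ := invSprof_le_two_mul hbs he' q
  have ha0 : 0 < solution B e q := (hsb q).1
  have ha2 : (solution B e q) ^ 2 ≤ (1 / sprof (2 * e') (bs / 4) q) ^ 2 := pow_le_pow_left₀ ha0.le (hle q) 2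
  have hw0 := profWeight_nonneg hbs he' q
  have heq : 3 / 4 * (solution B e q) ^ 5 * W q = 3 / 2 * (solution B e q) ^ 2 * ((solution B e q) ^ 3 / 2 * W q) := by ring
  have h1 : |3 / 4 * (solution B e q) ^ 5 * W q|
      ≤ 3 / 2 * (1 / sprof (2 * e') (bs / 4) q) ^ 2 * (1 / (sprof (2 * e') (bs / 4) q) ^ 2 * (1 / sprof (2 * e') (bs / 4) q)) := by
    rw [heq, abs_mul, abs_of_nonneg (by positivity : (0:ℝ) ≤ 3 / 2 * (solution B e q) ^ 2)]
    exact mul_le_mul (by nlinarith) hU (abs_nonneg _) (by positivity)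
  refine ⟨h1, h1.trans ?_⟩
  nlinarith

/-- THE ALGEBRA OF THE JACOBIAN SLOPE (numbers only): `(b³∕2 − a³∕2)∕δ + (3∕4)a⁵W = P·(s − U) + ((b − a)(b + 2a)∕2)·U` with `P = (b² + ba + a²)∕2 ≤ 6e′²`,
`s = (b − a)∕δ`, `U = −(a³∕2)W`, and the bounds of §133–§134 give `|·| ≤ w·((112∕3)e′⁴|δ| + 3e′²ε_D)`. [folklore] -/
theorem jacobianSlope_core {a b δ W w σ f εD : ℝ} (ha0 : 0 < a) (hb0 : 0 < b) (haσ : a ≤ σ) (hbσ : b ≤ σ) (hσf : σ ≤ 2 * f) (hf : 0 < f)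
    (hw0 : 0 ≤ w) (hw8 : w ≤ 8 * f ^ 3)
    (hba : |b - a| ≤ 2 / 3 * w * |δ|) (hU : |a ^ 3 / 2 * W| ≤ w) (hsU : |(b - a) / δ + a ^ 3 / 2 * W| ≤ w * (32 / 9 * f ^ 2 * |δ| + εD / 2)) :
    |(b ^ 3 / 2 - a ^ 3 / 2) / δ + 3 / 4 * a ^ 5 * W| ≤ w * (112 / 3 * f ^ 4 * |δ| + 3 * f ^ 2 * εD) := by
  have hσ0 : 0 < σ := ha0.trans_le haσ
  have hP : (b ^ 3 / 2 - a ^ 3 / 2) / δ + 3 / 4 * a ^ 5 * W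
      = (b ^ 2 + b * a + a ^ 2) / 2 * ((b - a) / δ - -(a ^ 3 / 2 * W)) + ((b - a) * (b + 2 * a) / 2) * -(a ^ 3 / 2 * W) := by ring
  rw [hP]
  have hsU' : |(b - a) / δ - -(a ^ 3 / 2 * W)| ≤ w * (32 / 9 * f ^ 2 * |δ| + εD / 2) := by rw [sub_neg_eq_add]; exact hsU
  have ha2 : a ^ 2 ≤ σ ^ 2 := pow_le_pow_left₀ ha0.le haσ 2
  have hb2 : b ^ 2 ≤ σ ^ 2 := pow_le_pow_left₀ hb0.le hbσ 2
  have hab : b * a ≤ σ * σ := mul_le_mul hbσ haσ ha0.le hσ0.le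
  have hσ2 : σ ^ 2 ≤ (2 * f) ^ 2 := pow_le_pow_left₀ hσ0.le hσf 2
  have hPbd : |(b ^ 2 + b * a + a ^ 2) / 2| ≤ 6 * f ^ 2 := by
    rw [abs_of_nonneg (by positivity)]; nlinarith
  have hQbd : |(b - a) * (b + 2 * a) / 2| ≤ σ * w * |δ| := by
    rw [abs_div, abs_mul, abs_of_nonneg (by positivity : (0:ℝ) ≤ b + 2 * a), abs_two]
    have h3 : b + 2 * a ≤ 3 * σ := by linarith
    have h0 : 0 ≤ 2 / 3 * w * |δ| := by positivity
    calc |b - a| * (b + 2 * a) / 2 ≤ 2 / 3 * w * |δ| * (3 * σ) / 2 :=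
          div_le_div_of_nonneg_right (mul_le_mul hba h3 (by positivity) h0) zero_le_two
      _ = σ * w * |δ| := by ring
  have hUw : |-(a ^ 3 / 2 * W)| ≤ w := by rw [abs_neg]; exact hU
  have hwδ : 0 ≤ w * |δ| := by positivity
  calc |(b ^ 2 + b * a + a ^ 2) / 2 * ((b - a) / δ - -(a ^ 3 / 2 * W)) + (b - a) * (b + 2 * a) / 2 * -(a ^ 3 / 2 * W)|
      ≤ |(b ^ 2 + b * a + a ^ 2) / 2 * ((b - a) / δ - -(a ^ 3 / 2 * W))| + |(b - a) * (b + 2 * a) / 2 * -(a ^ 3 / 2 * W)| := abs_add_le _ _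
    _ = |(b ^ 2 + b * a + a ^ 2) / 2| * |(b - a) / δ - -(a ^ 3 / 2 * W)| + |(b - a) * (b + 2 * a) / 2| * |-(a ^ 3 / 2 * W)| := by
        rw [abs_mul, abs_mul]
    _ ≤ 6 * f ^ 2 * (w * (32 / 9 * f ^ 2 * |δ| + εD / 2)) + σ * w * |δ| * w :=
        add_le_add (mul_le_mul hPbd hsU' (abs_nonneg _) (by positivity)) (mul_le_mul hQbd hUw (abs_nonneg _) (by positivity))
    _ ≤ 6 * f ^ 2 * (w * (32 / 9 * f ^ 2 * |δ| + εD / 2)) + 2 * f * (w * |δ|) * (8 * f ^ 3) := by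
        have h1 : σ * w * |δ| * w = σ * (w * |δ|) * w := by ring
        rw [h1]
        have h2 : σ * (w * |δ|) * w ≤ 2 * f * (w * |δ|) * (8 * f ^ 3) :=
          mul_le_mul (mul_le_mul_of_nonneg_right hσf hwδ) hw8 hw0 (by positivity)
        linarith
    _ = w * (112 / 3 * f ^ 4 * |δ| + 3 * f ^ 2 * εD) := by ring

/-- **THE CHART SLOPES OF THE JACOBIAN AGAINST ITS CHART-DERIVATIVE, AT EVERY SCALE AT ONCE, WITH THE WEIGHT**: part 14's package at e′, `hG`, W the tangent flow at
`e ∈ ]0, e′]`, a second pin `ẽ ≠ e` in ]0, e′] and a bound `ε_D` on `sup_k |D_k − W_k|`; for EVERY q: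
**`|(h̃_q³∕2 − h_q³∕2)∕δ̂ + (3∕4)h_q⁵W_q| ≤ w_q·((112∕3)·e′⁴·|δ̂| + 3e′²·ε_D)`** (`(ṽ − v)∕δ̂ = P·s` with `P = (h̃² + h̃h + h²)∕2 ≤ 6e′²`, `s = (h̃ − h)∕δ̂`;
`P·s − (3h²∕2)U = P(s − U) + (P − 3h²∕2)U`, `|P − 3h²∕2| ≤ (3σ∕2)|h̃ − h| ≤ σ w|δ̂|`, `|U| ≤ w ≤ 8e′³`, §133–§134).
[cite: Balaban1987RG1, Thm 2 (0.31) p.259 with (0.20) p.256 and p.298] -/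
theorem jacobianSlope_sub_abs_le {B : (ℕ → ℝ) → ℝ} {G : (ℕ → ℝ) → ℕ → ℝ} {Cm θ γ bs ta gs e' εD : ℝ} {t W : ℕ → ℝ}
    (hB : MemoryProfile Cm θ γ B) (hCm : 0 ≤ Cm) (hθ0 : 0 ≤ θ) (hθ1 : θ < 1) (hbs : 0 < bs) (hta : 0 < ta)
    (hts : SeqBox γ t) (htf : MemFlow B gs t) (hprof : ∀ m : ℕ, 1 / ta ^ 2 + bs * (m : ℝ) ≤ 1 / (t m) ^ 2)
    (hG : ∀ u : ℕ → ℝ, SeqBox γ u → ∀ j, |G u j| ≤ Cm * θ ^ j)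
    (h2e' : 2 * e' ≤ γ) (hs1 : 4 * Cm * e' ≤ bs * (1 - θ))
    (hs2 : e' ^ 2 * (1 / gs ^ 2 + Cm * γ / (1 - θ) ^ 2 + (2 * Cm / ((1 - θ) * bs)) ^ 2) ≤ 3 / 4)
    (hs4 : 64 * Cm * e' ^ 3 ≤ (1 - θ) ^ 2) (hs5 : Cm * (8 * e' ^ 3 + 16 * e' / bs) ≤ (1 - θ) / 4)
    {e ee : ℝ} (he : e ∈ Ioc (0 : ℝ) e') (hee : ee ∈ Ioc (0 : ℝ) e') (hne : ee ≠ e)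
    (hW : ∀ k, W k = 1 - ∑ p ∈ range k, ∑' j, G (fun i => solution B e (p + 1 + i)) j * ((solution B e (p + 1 + j)) ^ 3 / 2) * W (p + 1 + j))
    (hWM : ∀ k, |W k| ≤ 2)
    (hD : ∀ k, |(1 / (solution B ee k) ^ 2 - 1 / (solution B e k) ^ 2) / (1 / ee ^ 2 - 1 / e ^ 2) - W k| ≤ εD) (q : ℕ) :
    |((solution B ee q) ^ 3 / 2 - (solution B e q) ^ 3 / 2) / (1 / ee ^ 2 - 1 / e ^ 2) + 3 / 4 * (solution B e q) ^ 5 * W q|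
      ≤ (1 / (sprof (2 * e') (bs / 4) q) ^ 2 * (1 / sprof (2 * e') (bs / 4) q)) * (112 / 3 * e' ^ 4 * |1 / ee ^ 2 - 1 / e ^ 2| + 3 * e' ^ 2 * εD) := by
  have he' : 0 < e' := he.1.trans_le he.2
  obtain ⟨hsb, -, -, hle, -, -⟩ := solution_facts hB hCm hθ0 hθ1 hbs hta hts htf hprof h2e' hs1 hs2 hs4 hs5 he
  obtain ⟨hsbb, -, -, hlee, -, -⟩ := solution_facts hB hCm hθ0 hθ1 hbs hta hts htf hprof h2e' hs1 hs2 hs4 hs5 hee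
  obtain ⟨hba, -⟩ := abs_sub_pins_le_of_quotient hB hCm hθ0 hθ1 hbs hta hts htf hprof h2e' hs1 hs2 hs4 hs5 he hee hne q
  obtain ⟨-, -, hU⟩ := chartDeriv_facts hB hCm hθ0 hθ1 hbs hta hts htf hprof hG h2e' hs1 hs2 hs4 hs5 he hW hWM q
  have hsU := chartSlope_sub_chartDeriv_abs_le hB hCm hθ0 hθ1 hbs hta hts htf hprof h2e' hs1 hs2 hs4 hs5 he hee hne hD q
  obtain ⟨hσ1, -, -⟩ := invSprof_le_two_mul hbs he' q
  have hw8 : 1 / (sprof (2 * e') (bs / 4) q) ^ 2 * (1 / sprof (2 * e') (bs / 4) q) ≤ 8 * e' ^ 3 := by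
    have h := profWeight_anti hbs he' (Nat.zero_le q)
    rw [sprof_zero (by positivity : (0:ℝ) < 2 * e')] at h
    have e8 : 1 / (1 / (2 * e')) ^ 2 * (1 / (1 / (2 * e'))) = 8 * e' ^ 3 := by field_simp; ring
    rw [e8] at h
    exact h
  exact jacobianSlope_core (hsb q).1 (hsbb q).1 (hle q) (hlee q) hσ1 he' (profWeight_nonneg hbs he' q) hw8 hba hU hsU

/-- **THE CHART SLOPES OF THE JACOBIAN CONVERGE TO ITS CHART-DERIVATIVE, UNIFORMLY IN THE SCALE, WITH THE WEIGHT**: under part 68's C¹ shape at an interior pin, for every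
ε₀ > 0, for all ẽ ≠ e close enough to e: ẽ ∈ ]0, e′] and **`|(h̃_q³∕2 − h_q³∕2)∕δ̂ + (3∕4)h_q⁵W_q| ≤ ε₀·w_q` FOR EVERY q**.
[cite: Balaban1987RG1, Thm 2 (0.31) p.259 with (0.20) p.256 and p.298] -/
theorem jacobianSlope_tendsto_uniform {B : (ℕ → ℝ) → ℝ} {G : (ℕ → ℝ) → ℕ → ℝ} {Cm θ γ bs ta gs e' : ℝ} {t W : ℕ → ℝ}
    (hB : MemoryProfile Cm θ γ B) (hCm : 0 ≤ Cm) (hθ0 : 0 ≤ θ) (hθ1 : θ < 1) (hbs : 0 < bs) (hta : 0 < ta)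
    (hts : SeqBox γ t) (htf : MemFlow B gs t) (hprof : ∀ m : ℕ, 1 / ta ^ 2 + bs * (m : ℝ) ≤ 1 / (t m) ^ 2)
    (hG : ∀ u : ℕ → ℝ, SeqBox γ u → ∀ j, |G u j| ≤ Cm * θ ^ j)
    (hGB : ∀ ε > 0, ∃ ρ > 0, ∀ u u' : ℕ → ℝ, SeqBox γ u → SeqBox γ u' → (∀ j, |u' j - u j| ≤ ρ) →
      |B u' - B u - ∑' j, G u j * (u' j - u j)| ≤ ε * ∑' j, θ ^ j * |u' j - u j|)
    (h2e' : 2 * e' ≤ γ) (hs1 : 4 * Cm * e' ≤ bs * (1 - θ))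
    (hs2 : e' ^ 2 * (1 / gs ^ 2 + Cm * γ / (1 - θ) ^ 2 + (2 * Cm / ((1 - θ) * bs)) ^ 2) ≤ 3 / 4)
    (hs4 : 64 * Cm * e' ^ 3 ≤ (1 - θ) ^ 2) (hs5 : Cm * (8 * e' ^ 3 + 16 * e' / bs) ≤ (1 - θ) / 4) {e : ℝ} (he : e ∈ Ioo (0 : ℝ) e')
    (hW : ∀ k, W k = 1 - ∑ p ∈ range k, ∑' j, G (fun i => solution B e (p + 1 + i)) j * ((solution B e (p + 1 + j)) ^ 3 / 2) * W (p + 1 + j))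
    (hWM : ∀ k, |W k| ≤ 2) {ε₀ : ℝ} (hε₀ : 0 < ε₀) :
    ∀ᶠ ee in 𝓝[≠] e, ee ∈ Ioc (0 : ℝ) e' ∧ ∀ q,
      |((solution B ee q) ^ 3 / 2 - (solution B e q) ^ 3 / 2) / (1 / ee ^ 2 - 1 / e ^ 2) + 3 / 4 * (solution B e q) ^ 5 * W q|
        ≤ ε₀ * (1 / (sprof (2 * e') (bs / 4) q) ^ 2 * (1 / sprof (2 * e') (bs / 4) q)) := by
  have he' : 0 < e' := he.1.trans he.2
  have hec : e ∈ Ioc (0 : ℝ) e' := ⟨he.1, he.2.le⟩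
  -- ε_D with 3e′²ε_D ≤ ε₀∕2
  have hεD : 0 < ε₀ / (6 * e' ^ 2) := by positivity
  have hD := quotient_tendsto_tangent_uniform hB hCm hθ0 hθ1 hbs hta hts htf hprof hG hGB h2e' hs1 hs2 hs4 hs5 he hW hWM hεD
  have hsmall : ∀ᶠ ee in 𝓝 e, 112 / 3 * e' ^ 4 * |1 / ee ^ 2 - 1 / e ^ 2| ≤ ε₀ / 2 := by
    have h := invSq_sub_invSq_tendsto_zero he.1.ne'
    have hpos : 0 < 3 * ε₀ / (224 * e' ^ 4) := by positivity
    have := (Metric.tendsto_nhds.1 h) _ hpos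
    refine this.mono fun ee hee => ?_
    rw [Real.dist_eq, sub_zero] at hee
    have := (lt_div_iff₀ (by positivity : (0:ℝ) < 224 * e' ^ 4)).mp hee
    nlinarith [pow_pos he' 4, abs_nonneg (1 / ee ^ 2 - 1 / e ^ 2)]
  have hmem : ∀ᶠ ee in 𝓝 e, ee ∈ Ioc (0 : ℝ) e' := Filter.eventually_of_mem (Ioo_mem_nhds he.1 he.2) fun x hx => ⟨hx.1, hx.2.le⟩
  have hne : ∀ᶠ ee in 𝓝[≠] e, ee ≠ e := self_mem_nhdsWithin
  filter_upwards [hne, hD, eventually_nhdsWithin_of_eventually_nhds hsmall, eventually_nhdsWithin_of_eventually_nhds hmem] with ee hne' hD' hsm hee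
  refine ⟨hee, fun q => ?_⟩
  have hw0 := profWeight_nonneg hbs he' q
  have hmain := jacobianSlope_sub_abs_le hB hCm hθ0 hθ1 hbs hta hts htf hprof hG h2e' hs1 hs2 hs4 hs5 hec hee hne' hW hWM hD' q
  have h3 : 3 * e' ^ 2 * (ε₀ / (6 * e' ^ 2)) = ε₀ / 2 := by field_simp; ring
  calc _ ≤ (1 / (sprof (2 * e') (bs / 4) q) ^ 2 * (1 / sprof (2 * e') (bs / 4) q)) * (112 / 3 * e' ^ 4 * |1 / ee ^ 2 - 1 / e ^ 2| + 3 * e' ^ 2 * (ε₀ / (6 * e' ^ 2))) :=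
        hmain
    _ ≤ (1 / (sprof (2 * e') (bs / 4) q) ^ 2 * (1 / sprof (2 * e') (bs / 4) q)) * (ε₀ / 2 + ε₀ / 2) :=
        mul_le_mul_of_nonneg_left (by rw [h3]; linarith) hw0
    _ = ε₀ * (1 / (sprof (2 * e') (bs / 4) q) ^ 2 * (1 / sprof (2 * e') (bs / 4) q)) := by ring

end

end Summit.QuantumFields.BalabanUV.Beta.EriceFlowEnclosureB12AsPrintedHistoryContagionShiftFlowZeroTangentPin
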